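import Summits.NavierStokesRegularity.NavierStokesRegularity.Theorems.SoloInformedDissipativeVertex

/-!
# Grönwall rigidity: the energy class closes a Grönwall estimate only on exact Euler invariants

Solo seat `solo-NavierStokesRegularity-informed` (new mathematics *about the summit statement*; a
corollary of the vertex principle of `SoloInformedDissipativeVertex`, paper §3.1 Theorem L7).

The standard route to an a priori bound for Clay (A) is a differential inequality
`(d/dt) Q(u(t)) ≤ Φ(u(t))` for a coercive quantity `Q`, closed by Grönwall's lemma from what the
Leray energy class provides a priori (`sup_t ∫|u|²` and `∫₀^∞ ∫|∇u|² dt`). Write the Navier–Stokes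
rate of an even bi-homogeneous `Q` (amplitude degree `d`, dilation degree `e`, Navier–Stokes weight
`w = d + e`) as `ν A(u) + B(u)` with the *Stokes rate* `A(u) = Q'(u)[Δu]` (law `l ^ d * m ^ (e + 2)`)
and the *Euler rate* `B(u) = -Q'(u)[P∇·(u ⊗ u)]` (law `l ^ (d + 1) * m ^ (e + 1)`, odd under
`u ↦ -u`); both have Navier–Stokes weight `w + 2`. Suppose the inequality
`ν A(u) + B(u) ≤ ∑ⱼ Rⱼ(u)` holds for EVERY Schwartz divergence-free `u`, where each bound term `Rⱼ`
transforms with `l ^ dRⱼ * m ^ eRⱼ` and is **subcritical relative to the rate**: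
`dRⱼ + eRⱼ < w + 2`. Every right-hand side that Grönwall's lemma can close from the energy class is
of this kind: `C · Q · ‖∇u‖²_{L²} · E^m` has weight `w + 1 - m`, and `C · Q · ‖u‖_{L^r}^s` with the
energy-class exponents `2/s + 3/r = 3/2` has weight `w + 2 - s/2`; the scale-invariant
(Prodi–Serrin / Beale–Kato–Majda) right-hand sides have weight exactly `w + 2` and are excluded —
they are criteria, not bounds. THEN `B ≡ 0` and `ν A ≤ 0`: the quantity is an exact conservation law
of the Euler dynamics with the Stokes sign. In words: *the energy class closes a Grönwall estimate for
a bi-homogeneous quantity only if that quantity is already an exact Euler invariant* — energy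
supercriticality as a rigidity statement about every candidate `Q`, not only about `E`
(e.g. `(d/dt)‖ω‖²_{L²} ≤ C ‖ω‖²_{L²} ‖∇u‖²_{L²}` is false on some Schwartz field, because vortex
stretching is not identically zero; the true enstrophy inequality `≤ C ν⁻³ ‖ω‖⁶_{L²}` sits exactly at
the critical weight).

Proof: the Navier–Stokes zoom `u ↦ (s t) • u(t ·)`, `t → ∞`, kills the subcritical right-hand side
(isolation of the top `t`-exponent `w + 2`, lemma `coeff_nonpos_of_exponent_lt` of the imported
file), leaving `ν s ^ d A(u) + s ^ (d + 1) B(u) ≤ 0` for all `s > 0`; the amplitude parameter `s`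
then isolates `B(u) ≤ 0` (`s → ∞`) and `ν A(u) ≤ 0` (`s → 0`), and oddness gives `B ≡ 0`.
As in the imported file everything is proved over an ABSTRACT carrier `X` with abstract scaling maps
`T l m` and involution `neg`; the transformation laws, which for genuine functionals follow from the
chain rule (paper §3.1, Lemma L1), are the hypotheses. Elementary real analysis. [folklore-level; the
heuristic "supercritical ⇒ no Grönwall" is Tao's (2007/2016); no source states this rigidity lemma]
-/

noncomputable section

open Filter Topology Finset
open scoped BigOperators

namespace Summit.NavierStokesRegularity.NavierStokesRegularity.Theorems

section Gronwall

variable {X J : Type*} [Fintype J]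

variable (T : ℝ → ℝ → X → X) (neg : X → X) (ν d e : ℝ) (A B : X → ℝ)
  (dR eR : J → ℝ) (R : J → X → ℝ)
  (hS : ∀ (l m : ℝ) (u : X), 0 < l → 0 < m → A (T l m u) = l ^ d * m ^ (e + 2) * A u)
  (hE : ∀ (l m : ℝ) (u : X), 0 < l → 0 < m → B (T l m u) = l ^ (d + 1) * m ^ (e + 1) * B u)
  (hR : ∀ (j : J) (l m : ℝ) (u : X), 0 < l → 0 < m →
    R j (T l m u) = l ^ (dR j) * m ^ (eR j) * R j u)
  (hod : ∀ u, B (neg u) = -B u)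
  (hw : ∀ j, dR j + eR j < d + e + 2)
  (hineq : ∀ u, ν * A u + B u ≤ ∑ j, R j u)

include hS hE hR hw hineq in
/-- **Step 1 (the Navier–Stokes zoom kills a subcritical bound).** Along `u ↦ T (s * t) t u`
(amplitude `s * t`, dilation `t`) the rate terms carry `t ^ (d + e + 2)` and every bound term a
strictly smaller power of `t`; letting `t → ∞` leaves `ν s ^ d A u + s ^ (d + 1) B u ≤ 0` for every
amplitude `s > 0`. [folklore] -/
theorem nsRate_nonpos_of_subcriticalBound (u : X) (s : ℝ) (hs : 0 < s) :
    ν * (s ^ d * A u) + s ^ (d + 1) * B u ≤ 0 := by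
  classical
  have key := coeff_nonpos_of_exponent_lt (κ := Option J)
    (fun k => Option.elim k (ν * (s ^ d * A u) + s ^ (d + 1) * B u)
      (fun j => -(s ^ (dR j) * R j u)))
    (fun k => Option.elim k (d + e + 2) (fun j => dR j + eR j)) none ?_ ?_
  · simpa using key
  · intro k hk
    obtain ⟨j, rfl⟩ := Option.ne_none_iff_exists'.mp hk
    simpa using hw j
  · intro t ht
    have hst : 0 < s * t := mul_pos hs ht
    have hR' : ∀ j, R j (T (s * t) t u) = (s * t) ^ (dR j) * t ^ (eR j) * R j u :=
      fun j => hR j _ _ u hst ht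
    have h := hineq (T (s * t) t u)
    rw [hS _ _ u hst ht, hE _ _ u hst ht] at h
    simp only [hR'] at h
    have hsum : ∑ j, (-(s ^ (dR j) * R j u)) * t ^ (dR j + eR j)
        = -∑ j, (s * t) ^ (dR j) * t ^ (eR j) * R j u := by
      rw [← Finset.sum_neg_distrib]
      refine Finset.sum_congr rfl fun j _ => ?_
      rw [Real.mul_rpow hs.le ht.le, Real.rpow_add ht]
      ring
    have hA' : (s * t) ^ d * t ^ (e + 2) = s ^ d * t ^ (d + e + 2) := by
      rw [Real.mul_rpow hs.le ht.le, show d + e + 2 = d + (e + 2) by ring, Real.rpow_add ht d (e + 2)]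
      ring
    have hB' : (s * t) ^ (d + 1) * t ^ (e + 1) = s ^ (d + 1) * t ^ (d + e + 2) := by
      rw [Real.mul_rpow hs.le ht.le, show d + e + 2 = (d + 1) + (e + 1) by ring,
        Real.rpow_add ht (d + 1) (e + 1)]
      ring
    have main : (ν * (s ^ d * A u) + s ^ (d + 1) * B u) * t ^ (d + e + 2)
        + ∑ j, (-(s ^ (dR j) * R j u)) * t ^ (dR j + eR j) ≤ 0 := by
      rw [hsum]
      rw [hA', hB'] at h
      have h' := sub_nonpos.mpr h
      have eq : (ν * (s ^ d * A u) + s ^ (d + 1) * B u) * t ^ (d + e + 2)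
          + -∑ j, (s * t) ^ (dR j) * t ^ (eR j) * R j u
          = ν * (s ^ d * t ^ (d + e + 2) * A u) + s ^ (d + 1) * t ^ (d + e + 2) * B u
            - ∑ j, (s * t) ^ (dR j) * t ^ (eR j) * R j u := by ring
      rw [eq]
      exact h'
    simpa [Fintype.sum_option] using main

include hS hE hR hod hw hineq in
/-- **Grönwall rigidity, inertial part.** If the Navier–Stokes rate of an even bi-homogeneous quantity
is bounded, on all fields, by finitely many terms each of Navier–Stokes weight strictly below that of
the rate (`dRⱼ + eRⱼ < d + e + 2`) — in particular by any right-hand side Grönwall's lemma can close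
from the Leray energy class — then its Euler rate vanishes identically: the quantity is an exact
conservation law of the Euler dynamics. (Paper §3.1, Theorem L7.) [folklore] -/
theorem eulerRate_eq_zero_of_subcriticalBound : ∀ u, B u = 0 := by
  classical
  have hle : ∀ u, B u ≤ 0 := by
    intro u
    have key := coeff_nonpos_of_exponent_lt (κ := Bool)
      (fun b => cond b (B u) (ν * A u)) (fun b => cond b (d + 1) d) true ?_ ?_
    · simpa using key
    · intro k hk
      cases k with
      | true => exact (hk rfl).elim
      | false => simp
    · intro s hs
      have h := nsRate_nonpos_of_subcriticalBound T ν d e A B dR eR R hS hE hR hw hineq u s hs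
      have eq : ∑ b : Bool, cond b (B u) (ν * A u) * s ^ (cond b (d + 1) d)
          = ν * (s ^ d * A u) + s ^ (d + 1) * B u := by
        rw [Fintype.sum_bool]
        simp only [cond_true, cond_false]
        ring
      rw [eq]
      exact h
  intro u
  have h₁ := hle u
  have h₂ := hle (neg u)
  rw [hod] at h₂
  linarith

include hS hE hR hw hineq in
/-- **Grönwall rigidity, viscous part.** Under the same subcritical bound the Stokes rate has the
dissipative sign, `ν A u ≤ 0` for every `u` (amplitude `s → 0`, i.e. the top exponent after
`s ↦ s⁻¹`). (Paper §3.1, Theorem L7.) [folklore] -/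
theorem stokesRate_nonpos_of_subcriticalBound : ∀ u, ν * A u ≤ 0 := by
  classical
  intro u
  have key := coeff_nonpos_of_exponent_lt (κ := Bool)
    (fun b => cond b (B u) (ν * A u)) (fun b => cond b (-(d + 1)) (-d)) false ?_ ?_
  · simpa using key
  · intro k hk
    cases k with
    | true => simp
    | false => exact (hk rfl).elim
  · intro s hs
    have hs' : 0 < s⁻¹ := inv_pos.mpr hs
    have h := nsRate_nonpos_of_subcriticalBound T ν d e A B dR eR R hS hE hR hw hineq u s⁻¹ hs'
    have e1 : s⁻¹ ^ d = s ^ (-d) := by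
      rw [Real.inv_rpow hs.le, Real.rpow_neg hs.le]
    have e2 : s⁻¹ ^ (d + 1) = s ^ (-(d + 1)) := by
      rw [Real.inv_rpow hs.le, Real.rpow_neg hs.le]
    rw [e1, e2] at h
    have eq : ∑ b : Bool, cond b (B u) (ν * A u) * s ^ (cond b (-(d + 1)) (-d))
        = ν * (s ^ (-d) * A u) + s ^ (-(d + 1)) * B u := by
      rw [Fintype.sum_bool]
      simp only [cond_true, cond_false]
      ring
    rw [eq]
    exact h

end Gronwall

end Summit.NavierStokesRegularity.NavierStokesRegularity.Theorems
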